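import Mathlib.Algebra.Order.Chebyshev
import Mathlib.Probability.Moments.Variance
import Literature.Barriers.CriticalPhenomena.SpanningClustersAboveSixMoments
import HarnessLib

/-!
# Proof of the barrier `SpanningClustersAboveSix` (Aizenman 1997, Thm. 4 (1) and (3))

Barrier catalogue `Literature/Barriers/CriticalPhenomena/` (D-0021). This file discharges the named
fact `SpanningClustersAboveSix` of `SpanningClustersAboveSix.lean`:
`theorem SpanningClustersAboveSix_holds : SpanningClustersAboveSix` — in every dimension `d > 6`,
under condition (t-c) with `η = 0` (`TwoPointBoundedRatio d`), the critical spanning probability of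
`Λ_L` (bulk b.c.) tends to one and `P_{p_c}(N_L ≥ o(1) L^{d-6}) → 1` for every `o(1) → 0`.

## The argument (Aizenman 1997, §4, proof of Thm. 4 from Lemmas 2–4)

With `∂Λ_∓` the two faces, let `K = #{(x,y) ∈ ∂Λ_- × ∂Λ_+ : x ↔ y} = Σ_C |C∩∂Λ_-||C∩∂Λ_+|`
(sum over spanning clusters `C`) and `S = Σ_C |C∩∂Λ_-|²|C∩∂Λ_+|²`
(`= #{(x,y,x',y') : all four connected}`). Then

* `E K = Σ τ(x,y) ≥ c L^d` (`le_sum_faces_tau`, Aizenman 1997, proof of Lemma 3);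
* `Var K ≤ T := Σ τ₄(x,x',y,y') ≤ C L^{d+6}` by the truncation lemma (Aizenman 1997, Lemma 4,
  `real_openConn_inter_le_tau`) and the tree-diagram estimate (ibid. Lemma 2 and proof of Lemma 3,
  `sum_real_openConn₄_le`); also `E S = T`;
* Chebyshev: `P(K ≤ E K/2) ≤ 4T/(E K)² ≲ L^{6-d} → 0` (ibid. proof of Lemma 3); Markov:
  `P(S > M) ≤ T/M`;
* by Cauchy–Schwarz over the spanning clusters, `K² ≤ N_L · S` (`connPairCount_sq_le`), so on
  `{K > EK/2} ∩ {S ≤ M}` with `M = (EK/2)²/(ε L^{d-6})` one has `N_L ≥ ε L^{d-6}`, while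
  `T/M ≲ ε → 0`.

The printed proof uses `N_L ≥ K / max_C |C∩∂Λ_-||C∩∂Λ_+|` and the bound
`max_C |C ∩ ∂Λ| ≤ c log L · L³` of Thm. 5; the Cauchy–Schwarz form `N_L ≥ K²/S` used here needs only the `k ≤ 2` moments
(Lemma 2 with `k = 2`, Lemma 3 with `k = 1`) and gives the "any `o(1)`" form of Thm. 4 (3)
without the logarithm. Item (1) follows from (3) with `o(1) = 1/L`.

## Contents

* `connPairCount`, `connQuadCount` (`K`, `S` as sums of indicators), `connClusterCount` (the
  number of open clusters met by `P × Q`-pairs), the cluster identities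
  `connPairCount_eq_sum_clusters`, `connQuadCount_eq_sum_clusters`, Cauchy–Schwarz
  `connPairCount_sq_le`, and `connClusterCount_le_numSpanningClusters`;
* the second-moment package for `K` and `S` under any Bernoulli bond percolation measure
  (`meanConnPairCount = E K`, `connQuadSum = T = E S`):
  `integral_connPairCount`, `integral_connPairCount_sq_le`, `variance_connPairCount_le`,
  `real_connPairCount_le_half_le` (Chebyshev), `real_connQuadCount_ge_le` (Markov),
  `real_ge_of_connPairCount_connQuadCount`;
* the assembly on `ℤ^d`, `d = m + 7`: `real_numSpanning_ge` and `SpanningClustersAboveSix_holds`.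

## References

* M. Aizenman, *On the number of incipient spanning clusters*, Nuclear Phys. B 485 (1997)
  551–582, arXiv:cond-mat/9609240, §4 of the arXiv version ("Above the upper critical
  dimension"; equations (4.x); the catalogue file `SpanningClustersAboveSix.lean` refers to the
  same section as §5): Thm. 4, Thm. 5, Lemmas 2–4 and their proofs.
-/

noncomputable section

namespace Literature.Barriers.CriticalPhenomena

open _root_.MeasureTheory ProbabilityTheory Filter Finset Literature.Probability.LatticeModels
  Literature.Probability.Percolation
open scoped ENNReal _root_.Topology

/-! ### Counting pairs, quadruples and clusters -/

section Counting

variable {V : Type*} (P Q : Finset V)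

/-- `K(ω) = #{(x,y) ∈ P × Q : x ↔ y}`, as a real-valued sum of indicators (Aizenman 1997, proof of Lemma 3:
`K = Σ_{x∈∂Λ_-, y∈∂Λ_+} I[x ↔ y] = Σ_C |C∩∂Λ_-| |C∩∂Λ_+|`).
[cite: Aizenman1997, §4 (proof of Lemma 3: the variable K)] -/
def connPairCount (ω : BondConfig V) : ℝ :=
  ∑ a ∈ P ×ˢ Q, (openConn a.1 a.2 : Set (BondConfig V)).indicator 1 ω

/-- `S(ω) = #{((x,y),(x',y')) ∈ (P × Q)² : x, x', y, y' all connected} = Σ_C |C∩P|² |C∩Q|²`, as a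
real-valued sum of indicators (the `k = 2` moment of Aizenman 1997, Lemma 2, restricted to
the faces). [cite: Aizenman1997, §4 Lemma 2] -/
def connQuadCount (ω : BondConfig V) : ℝ :=
  ∑ q ∈ (P ×ˢ Q) ×ˢ (P ×ˢ Q), (openConn₄ q.1.1 q.2.1 q.1.2 q.2.2 : Set (BondConfig V)).indicator 1 ω

open Classical in
/-- The number of open clusters containing both points of some pair `(x,y) ∈ P × Q` (for the faces:
the number `N_L` of spanning clusters, counted through `∂Λ_- × ∂Λ_+`). [cite: Aizenman1997, §4 (N_L)] -/
def connClusterCount (ω : BondConfig V) : ℕ :=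
  #((P.image (openGraph ω).connectedComponentMk).filter fun C =>
    ∃ a ∈ P ×ˢ Q, (openGraph ω).connectedComponentMk a.1 = C ∧
      (openGraph ω).connectedComponentMk a.2 = C)

/-- `K ≥ 0`. [folklore] -/
theorem connPairCount_nonneg (ω : BondConfig V) : 0 ≤ connPairCount P Q ω :=
  Finset.sum_nonneg fun _ _ => Set.indicator_nonneg (fun _ _ => zero_le_one) _

/-- `K ≤ |P × Q|`. [folklore] -/
theorem connPairCount_le_card (ω : BondConfig V) : connPairCount P Q ω ≤ #(P ×ˢ Q) := by
  unfold connPairCount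
  calc ∑ a ∈ P ×ˢ Q, (openConn a.1 a.2 : Set (BondConfig V)).indicator 1 ω
      ≤ ∑ _a ∈ P ×ˢ Q, (1 : ℝ) :=
        Finset.sum_le_sum fun _ _ => Set.indicator_le_self' (fun _ _ => zero_le_one) _
    _ = #(P ×ˢ Q) := by rw [Finset.sum_const, nsmul_eq_mul, mul_one]

/-- `S ≥ 0`. [folklore] -/
theorem connQuadCount_nonneg (ω : BondConfig V) : 0 ≤ connQuadCount P Q ω :=
  Finset.sum_nonneg fun _ _ => Set.indicator_nonneg (fun _ _ => zero_le_one) _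

/-- `S ≤ |P × Q|²`. [folklore] -/
theorem connQuadCount_le_card (ω : BondConfig V) : connQuadCount P Q ω ≤ #((P ×ˢ Q) ×ˢ (P ×ˢ Q)) := by
  unfold connQuadCount
  calc ∑ q ∈ (P ×ˢ Q) ×ˢ (P ×ˢ Q), (openConn₄ q.1.1 q.2.1 q.1.2 q.2.2 : Set (BondConfig V)).indicator 1 ω
      ≤ ∑ _q ∈ (P ×ˢ Q) ×ˢ (P ×ˢ Q), (1 : ℝ) :=
        Finset.sum_le_sum fun _ _ => Set.indicator_le_self' (fun _ _ => zero_le_one) _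
    _ = #((P ×ˢ Q) ×ˢ (P ×ˢ Q)) := by rw [Finset.sum_const, nsmul_eq_mul, mul_one]

open Classical in
/-- The indicator of `{x ↔ y}` at `ω` is `1[C(x) = C(y)]` for the open clusters of `ω`. [folklore] -/
theorem indicator_openConn_eq_ite (ω : BondConfig V) (x y : V) :
    (openConn x y : Set (BondConfig V)).indicator (1 : BondConfig V → ℝ) ω =
      if (openGraph ω).connectedComponentMk x = (openGraph ω).connectedComponentMk y then 1 else 0 := by
  classical
  rw [Set.indicator_apply, Pi.one_apply]
  exact if_congr (SimpleGraph.ConnectedComponent.eq (G := openGraph ω)).symm rfl rfl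

open Classical in
/-- The indicator of `{x, x', y, y' all connected}` at `ω` in terms of the open clusters of `ω`.
[folklore] -/
theorem indicator_openConn₄_eq_ite (ω : BondConfig V) (x x' y y' : V) :
    (openConn₄ x x' y y' : Set (BondConfig V)).indicator (1 : BondConfig V → ℝ) ω =
      if (openGraph ω).connectedComponentMk x = (openGraph ω).connectedComponentMk x' ∧
          (openGraph ω).connectedComponentMk x = (openGraph ω).connectedComponentMk y ∧
          (openGraph ω).connectedComponentMk x = (openGraph ω).connectedComponentMk y' then 1 else 0 := by
  classical
  rw [Set.indicator_apply, Pi.one_apply]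
  refine if_congr ?_ rfl rfl
  rw [mem_openConn₄, SimpleGraph.ConnectedComponent.eq, SimpleGraph.ConnectedComponent.eq,
    SimpleGraph.ConnectedComponent.eq]

open Classical in
/-- **Cluster decomposition of `K`** (Aizenman 1997, proof of Lemma 3): `K = Σ_C k_C` over the open clusters
`C` meeting `P`, where `k_C = #{(x,y) ∈ P × Q : x, y ∈ C} = |C∩P| |C∩Q|`.
[cite: Aizenman1997, §4 (proof of Lemma 3: the variable K)] -/
theorem connPairCount_eq_sum_clusters (ω : BondConfig V) :
    connPairCount P Q ω = ∑ C ∈ P.image (openGraph ω).connectedComponentMk,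
      ∑ a ∈ P ×ˢ Q, (if (openGraph ω).connectedComponentMk a.1 = C ∧
        (openGraph ω).connectedComponentMk a.2 = C then (1 : ℝ) else 0) := by
  classical
  set cc := (openGraph ω).connectedComponentMk with hcc
  rw [Finset.sum_comm, connPairCount]
  refine Finset.sum_congr rfl fun a ha => ?_
  rw [indicator_openConn_eq_ite]
  have hmem : cc a.1 ∈ P.image cc := Finset.mem_image_of_mem cc (Finset.mem_product.1 ha).1
  calc (if cc a.1 = cc a.2 then (1 : ℝ) else 0)
      = if cc a.1 ∈ P.image cc then (if cc a.1 = cc a.2 then (1 : ℝ) else 0) else 0 := by rw [if_pos hmem]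
    _ = ∑ C ∈ P.image cc, if cc a.1 = C then (if C = cc a.2 then (1 : ℝ) else 0) else 0 := by
        rw [Finset.sum_ite_eq]
    _ = ∑ C ∈ P.image cc, if cc a.1 = C ∧ cc a.2 = C then (1 : ℝ) else 0 := by
        refine Finset.sum_congr rfl fun C _ => ?_
        rw [ite_and]
        by_cases h : cc a.1 = C
        · rw [if_pos h, if_pos h]; exact if_congr eq_comm rfl rfl
        · rw [if_neg h, if_neg h]

open Classical in
/-- **Cluster decomposition of `S`**: `S = Σ_C k_C²`. [cite: Aizenman1997, §4 Lemma 2] -/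
theorem connQuadCount_eq_sum_clusters (ω : BondConfig V) :
    connQuadCount P Q ω = ∑ C ∈ P.image (openGraph ω).connectedComponentMk,
      (∑ a ∈ P ×ˢ Q, (if (openGraph ω).connectedComponentMk a.1 = C ∧
        (openGraph ω).connectedComponentMk a.2 = C then (1 : ℝ) else 0)) ^ 2 := by
  classical
  set cc := (openGraph ω).connectedComponentMk with hcc
  set A := P ×ˢ Q with hA
  -- expand the squares
  have hsq : ∀ C, (∑ a ∈ A, (if cc a.1 = C ∧ cc a.2 = C then (1 : ℝ) else 0)) ^ 2 =
      ∑ a ∈ A, ∑ b ∈ A, if cc a.1 = C then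
        (if cc a.2 = C ∧ cc b.1 = C ∧ cc b.2 = C then (1 : ℝ) else 0) else 0 := by
    intro C
    rw [sq, Finset.sum_mul_sum]
    refine Finset.sum_congr rfl fun a _ => Finset.sum_congr rfl fun b _ => ?_
    by_cases h1 : cc a.1 = C <;> by_cases h2 : cc a.2 = C <;> by_cases h3 : cc b.1 = C <;>
      by_cases h4 : cc b.2 = C <;> simp [h1, h2, h3, h4]
  simp_rw [hsq]
  rw [Finset.sum_comm, connQuadCount, ← hA, Finset.sum_product]
  refine Finset.sum_congr rfl fun a ha => ?_
  rw [Finset.sum_comm]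
  refine Finset.sum_congr rfl fun b _ => ?_
  have hmem : cc a.1 ∈ P.image cc := Finset.mem_image_of_mem cc (Finset.mem_product.1 ha).1
  rw [Finset.sum_ite_eq, if_pos hmem, indicator_openConn₄_eq_ite]
  refine if_congr ⟨fun ⟨h1, h2, h3⟩ => ⟨h2.symm, h1.symm, h3.symm⟩,
    fun ⟨h1, h2, h3⟩ => ⟨h2.symm, h1.symm, h3.symm⟩⟩ rfl rfl

/-- **Cauchy–Schwarz over the spanning clusters**: `K² ≤ N · S`, where `N = connClusterCount` is the
number of clusters with `k_C ≠ 0` (`K = Σ_{k_C ≠ 0} k_C`, `S ≥ Σ_{k_C ≠ 0} k_C²`). This replaces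
`N_L ≥ K / max_C k_C` of the printed proof of Thm. 4. [cite: Aizenman1997, §4 (proof of Thm. 4)] -/
theorem connPairCount_sq_le (ω : BondConfig V) :
    connPairCount P Q ω ^ 2 ≤ (connClusterCount P Q ω : ℝ) * connQuadCount P Q ω := by
  classical
  set cc := (openGraph ω).connectedComponentMk with hcc
  set A := P ×ˢ Q with hA
  set T := P.image cc with hT
  set k : (openGraph ω).ConnectedComponent → ℝ := fun C =>
    ∑ a ∈ A, (if cc a.1 = C ∧ cc a.2 = C then (1 : ℝ) else 0) with hk
  set T' := T.filter (fun C => ∃ a ∈ A, cc a.1 = C ∧ cc a.2 = C) with hT'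
  have hK : connPairCount P Q ω = ∑ C ∈ T', k C := by
    rw [connPairCount_eq_sum_clusters, hT', Finset.sum_filter_of_ne]
    intro C _ hC
    by_contra h
    exact hC (Finset.sum_eq_zero fun a ha => if_neg fun h' => h ⟨a, ha, h'⟩)
  have hS : ∑ C ∈ T', k C ^ 2 ≤ connQuadCount P Q ω := by
    rw [connQuadCount_eq_sum_clusters]
    exact Finset.sum_le_sum_of_subset_of_nonneg (Finset.filter_subset _ _) fun C _ _ => sq_nonneg _
  have hN : (connClusterCount P Q ω : ℝ) = #T' := by
    simp only [connClusterCount, hT', hT, hA, hcc]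
  rw [hK, hN]
  exact (sq_sum_le_card_mul_sum_sq (s := T') (f := k)).trans
    (mul_le_mul_of_nonneg_left hS (Nat.cast_nonneg _))

/-- From `K² ≤ N S`, `K > 0`, `S ≤ M` and `r M < K²`: `r < N`. [folklore] -/
theorem lt_connClusterCount_of {ω : BondConfig V} {r M : ℝ} (hM : 0 < M) (hS : connQuadCount P Q ω ≤ M)
    (hr : r * M < connPairCount P Q ω ^ 2) : r < connClusterCount P Q ω := by
  have h := connPairCount_sq_le P Q ω
  have hN : (0 : ℝ) ≤ connClusterCount P Q ω := Nat.cast_nonneg _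
  have : r * M < connClusterCount P Q ω * M := lt_of_lt_of_le hr (h.trans (mul_le_mul_of_nonneg_left hS hN))
  exact lt_of_mul_lt_mul_right this hM.le

end Counting

/-! ### The spanning clusters of `Λ_L` -/

section Spanning

variable {d : ℕ} [NeZero d]

/-- Clusters met by a pair `(x,y) ∈ P × Q` with `P ⊆ ∂Λ_-`, `Q ⊆ ∂Λ_+` are spanning clusters:
`connClusterCount P Q ω ≤ N_L(ω)`. [cite: Aizenman1997, §4 (N_L)] -/
theorem connClusterCount_le_numSpanningClusters {P Q : Finset (Site d)} {L : ℕ}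
    (hP : ∀ x ∈ P, x ∈ leftFace d L) (hQ : ∀ y ∈ Q, y ∈ rightFace d L) (ω : BondConfig (Site d)) :
    (connClusterCount P Q ω : ℕ∞) ≤ numSpanningClusters d L ω := by
  classical
  unfold connClusterCount numSpanningClusters
  rw [← Set.encard_coe_eq_coe_finsetCard]
  refine Set.encard_le_encard fun C hC => ?_
  rw [Finset.mem_coe, Finset.mem_filter] at hC
  obtain ⟨-, a, ha, h1, h2⟩ := hC
  obtain ⟨hx, hy⟩ := Finset.mem_product.1 ha
  exact ⟨⟨a.1, hP _ hx, (SimpleGraph.ConnectedComponent.mem_supp_iff C a.1).2 h1⟩,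
    ⟨a.2, hQ _ hy, (SimpleGraph.ConnectedComponent.mem_supp_iff C a.2).2 h2⟩⟩

/-- If `N_L(ω) ≥ r > 0` in `ℝ≥0∞` then `Λ_L` is spanned. [folklore] -/
theorem mem_bulkSpanning_of_ofReal_le {L : ℕ} {r : ℝ} (hr : 0 < r) {ω : BondConfig (Site d)}
    (h : ENNReal.ofReal r ≤ (numSpanningClusters d L ω : ℝ≥0∞)) : ω ∈ bulkSpanning d L := by
  have hne : numSpanningClusters d L ω ≠ 0 := by
    intro h0
    rw [h0] at h
    simp only [ENat.toENNReal_zero, nonpos_iff_eq_zero, ENNReal.ofReal_eq_zero] at h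
    linarith
  obtain ⟨C, ⟨x, hx, hxC⟩, ⟨y, hy, hyC⟩⟩ := Set.encard_ne_zero.1 hne
  refine ⟨x, hx, y, hy, ?_⟩
  rw [SimpleGraph.ConnectedComponent.mem_supp_iff] at hxC hyC
  exact SimpleGraph.ConnectedComponent.eq.1 (hxC.trans hyC.symm)

/-- A real lower bound `r ≤ connClusterCount` transfers to `N_L` in `ℝ≥0∞`. [folklore] -/
theorem ofReal_le_numSpanningClusters {P Q : Finset (Site d)} {L : ℕ}
    (hP : ∀ x ∈ P, x ∈ leftFace d L) (hQ : ∀ y ∈ Q, y ∈ rightFace d L) {ω : BondConfig (Site d)}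
    {r : ℝ} (h : r ≤ connClusterCount P Q ω) :
    ENNReal.ofReal r ≤ (numSpanningClusters d L ω : ℝ≥0∞) :=
  calc ENNReal.ofReal r ≤ ENNReal.ofReal (connClusterCount P Q ω : ℝ) := ENNReal.ofReal_le_ofReal h
    _ = ((connClusterCount P Q ω : ℕ∞) : ℝ≥0∞) := by rw [ENNReal.ofReal_natCast, ENat.toENNReal_coe]
    _ ≤ (numSpanningClusters d L ω : ℝ≥0∞) :=
        ENat.toENNReal_le.2 (connClusterCount_le_numSpanningClusters hP hQ ω)

end Spanning

/-! ### The second-moment package for `K` and `S` -/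

section SecondMoment

variable {V : Type*} [Countable V] (G : SimpleGraph V) (p : unitInterval) (P Q : Finset V)

/-- `E K = Σ_{(x,y) ∈ P × Q} P_p(x ↔ y)`, the mean of `connPairCount` (Aizenman 1997, proof of
Lemma 3: `E(K) = Σ_{x∈∂Λ_-, y∈∂Λ_+} τ(x,y)`). [cite: Aizenman1997, §4 (proof of Lemma 3: E(K))] -/
def meanConnPairCount : ℝ := ∑ a ∈ P ×ˢ Q, (bondPercolation G p).real (openConn a.1 a.2)

/-- `T = Σ_{(x,y),(x',y') ∈ P × Q} τ₄(x,x',y,y')`, the mean of `connQuadCount` and the bound on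
`Var K` (Aizenman 1997, proof of Lemma 3). [cite: Aizenman1997, §4 (proof of Lemma 3: Var(K))] -/
def connQuadSum : ℝ :=
  ∑ q ∈ (P ×ˢ Q) ×ˢ (P ×ˢ Q), (bondPercolation G p).real (openConn₄ q.1.1 q.2.1 q.1.2 q.2.2)

omit [Countable V] in
/-- `E K ≥ 0`. [folklore] -/
theorem meanConnPairCount_nonneg : 0 ≤ meanConnPairCount G p P Q :=
  Finset.sum_nonneg fun _ _ => measureReal_nonneg

omit [Countable V] in
/-- `T ≥ 0`. [folklore] -/
theorem connQuadSum_nonneg : 0 ≤ connQuadSum G p P Q :=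
  Finset.sum_nonneg fun _ _ => measureReal_nonneg

/-- `K` is measurable. [folklore] -/
theorem measurable_connPairCount : Measurable (connPairCount P Q) :=
  Finset.measurable_sum _ fun a _ => measurable_one.indicator (measurableSet_openConn_holds a.1 a.2)

/-- `S` is measurable. [folklore] -/
theorem measurable_connQuadCount : Measurable (connQuadCount P Q) :=
  Finset.measurable_sum _ fun q _ => measurable_one.indicator (measurableSet_openConn₄ q.1.1 q.2.1 q.1.2 q.2.2)

/-- `S` is integrable. [folklore] -/
theorem integrable_connQuadCount : Integrable (connQuadCount P Q) (bondPercolation G p) := by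
  have hind : ∀ q : (V × V) × (V × V),
      Integrable ((openConn₄ q.1.1 q.2.1 q.1.2 q.2.2 : Set (BondConfig V)).indicator (1 : BondConfig V → ℝ))
        (bondPercolation G p) :=
    fun q => (integrable_const 1).indicator (measurableSet_openConn₄ q.1.1 q.2.1 q.1.2 q.2.2)
  exact integrable_finsetSum _ fun q _ => hind q

/-- `K` has all moments (it is bounded by `|P × Q|`). [folklore] -/
theorem memLp_connPairCount : MemLp (connPairCount P Q) 2 (bondPercolation G p) :=
  MemLp.of_bound (measurable_connPairCount P Q).aestronglyMeasurable (#(P ×ˢ Q)) (ae_of_all _ fun ω => by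
    rw [Real.norm_eq_abs, abs_of_nonneg (connPairCount_nonneg P Q ω)]
    exact connPairCount_le_card P Q ω)

/-- **`E K = Σ_{(x,y)} P_p(x ↔ y)`** (Aizenman 1997, proof of Lemma 3).
[cite: Aizenman1997, §4 (proof of Lemma 3: E(K))] -/
theorem integral_connPairCount :
    ∫ ω, connPairCount P Q ω ∂(bondPercolation G p) = meanConnPairCount G p P Q := by
  have hind : ∀ a : V × V,
      Integrable ((openConn a.1 a.2 : Set (BondConfig V)).indicator (1 : BondConfig V → ℝ)) (bondPercolation G p) :=
    fun a => (integrable_const 1).indicator (measurableSet_openConn_holds a.1 a.2)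
  unfold connPairCount meanConnPairCount
  rw [integral_finsetSum _ fun a _ => hind a]
  exact Finset.sum_congr rfl fun a _ => integral_indicator_one (measurableSet_openConn_holds a.1 a.2)

/-- **`E S = T = Σ τ₄`**. [cite: Aizenman1997, §4 Lemma 2 and its proof (τ_k)] -/
theorem integral_connQuadCount :
    ∫ ω, connQuadCount P Q ω ∂(bondPercolation G p) = connQuadSum G p P Q := by
  have hind : ∀ q : (V × V) × (V × V),
      Integrable ((openConn₄ q.1.1 q.2.1 q.1.2 q.2.2 : Set (BondConfig V)).indicator (1 : BondConfig V → ℝ))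
        (bondPercolation G p) :=
    fun q => (integrable_const 1).indicator (measurableSet_openConn₄ q.1.1 q.2.1 q.1.2 q.2.2)
  unfold connQuadCount connQuadSum
  rw [integral_finsetSum _ fun q _ => hind q]
  exact Finset.sum_congr rfl fun q _ => integral_indicator_one (measurableSet_openConn₄ q.1.1 q.2.1 q.1.2 q.2.2)

/-- **Second moment of `K`** (Aizenman 1997, proof of Lemma 3 with Lemma 4): `E K² = Σ P(x ↔ y, x' ↔ y') ≤
T + (E K)²`. [cite: Aizenman1997, §4 (proof of Lemma 3: Var(K)) and Lemma 4] -/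
theorem integral_connPairCount_sq_le :
    ∫ ω, connPairCount P Q ω ^ 2 ∂(bondPercolation G p) ≤
      connQuadSum G p P Q + meanConnPairCount G p P Q ^ 2 := by
  unfold connQuadSum meanConnPairCount
  set μ := bondPercolation G p with hμ
  have hmeas : ∀ a : V × V, MeasurableSet (openConn a.1 a.2 : Set (BondConfig V)) :=
    fun a => measurableSet_openConn_holds a.1 a.2
  have hpt : ∀ ω, connPairCount P Q ω ^ 2 =
      ∑ a ∈ P ×ˢ Q, ∑ b ∈ P ×ˢ Q, (openConn a.1 a.2 ∩ openConn b.1 b.2 : Set (BondConfig V)).indicator 1 ω := by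
    intro ω
    rw [connPairCount, sq, Finset.sum_mul_sum]
    refine Finset.sum_congr rfl fun a _ => Finset.sum_congr rfl fun b _ => ?_
    rw [Set.inter_indicator_one, Pi.mul_apply]
  have hint : ∀ a b : V × V,
      Integrable ((openConn a.1 a.2 ∩ openConn b.1 b.2 : Set (BondConfig V)).indicator (1 : BondConfig V → ℝ)) μ :=
    fun a b => (integrable_const 1).indicator ((hmeas a).inter (hmeas b))
  simp_rw [hpt]
  rw [integral_finsetSum _ fun a _ => integrable_finsetSum _ fun b _ => hint a b]
  calc ∑ a ∈ P ×ˢ Q, ∫ ω, ∑ b ∈ P ×ˢ Q, (openConn a.1 a.2 ∩ openConn b.1 b.2 : Set (BondConfig V)).indicator 1 ω ∂μ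
      = ∑ a ∈ P ×ˢ Q, ∑ b ∈ P ×ˢ Q, μ.real (openConn a.1 a.2 ∩ openConn b.1 b.2) := by
        refine Finset.sum_congr rfl fun a _ => ?_
        rw [integral_finsetSum _ fun b _ => hint a b]
        exact Finset.sum_congr rfl fun b _ => integral_indicator_one ((hmeas a).inter (hmeas b))
    _ ≤ ∑ a ∈ P ×ˢ Q, ∑ b ∈ P ×ˢ Q, (μ.real (openConn₄ a.1 b.1 a.2 b.2) +
          μ.real (openConn a.1 a.2) * μ.real (openConn b.1 b.2)) :=
        Finset.sum_le_sum fun a _ => Finset.sum_le_sum fun b _ => real_openConn_inter_le G p a.1 a.2 b.1 b.2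
    _ = _ := by
        rw [sq, Finset.sum_mul_sum, Finset.sum_product (s := P ×ˢ Q) (t := P ×ˢ Q), ← Finset.sum_add_distrib]
        exact Finset.sum_congr rfl fun a _ => by rw [Finset.sum_add_distrib]

/-- **`Var K ≤ T`** (Aizenman 1997, proof of Lemma 3). [cite: Aizenman1997, §4 (proof of Lemma 3: Var(K))] -/
theorem variance_connPairCount_le :
    variance (connPairCount P Q) (bondPercolation G p) ≤ connQuadSum G p P Q := by
  rw [variance_eq_sub (memLp_connPairCount G p P Q)]
  have h1 := integral_connPairCount_sq_le G p P Q
  have h2 := integral_connPairCount G p P Q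
  simp only [Pi.pow_apply]
  rw [h2]
  linarith

/-- **Chebyshev** (Aizenman 1997, proof of Lemma 3: "only very seldom will `K` differ by a significant
factor from the mean"): `P(K ≤ EK/2) ≤ 4T/(EK)²`.
[cite: Aizenman1997, §4 (proof of Lemma 3: Chebyshev step)] -/
theorem real_connPairCount_le_half_le (hEK : 0 < meanConnPairCount G p P Q) :
    (bondPercolation G p).real {ω | connPairCount P Q ω ≤ meanConnPairCount G p P Q / 2} ≤
      4 * connQuadSum G p P Q / meanConnPairCount G p P Q ^ 2 := by
  set μ := bondPercolation G p with hμ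
  set EK := meanConnPairCount G p P Q with hEKdef
  set T := connQuadSum G p P Q with hTdef
  have hc : 0 < EK / 2 := half_pos hEK
  have hcheb := meas_ge_le_variance_div_sq (memLp_connPairCount G p P Q) hc
  rw [integral_connPairCount] at hcheb
  have hvar := variance_connPairCount_le G p P Q
  have hsub : {ω | connPairCount P Q ω ≤ EK / 2} ⊆ {ω | EK / 2 ≤ |connPairCount P Q ω - EK|} := by
    intro ω hω
    rw [Set.mem_setOf_eq] at hω ⊢
    rw [abs_sub_comm]
    exact (le_abs_self _).trans' (by linarith)
  calc μ.real {ω | connPairCount P Q ω ≤ EK / 2} ≤ μ.real {ω | EK / 2 ≤ |connPairCount P Q ω - EK|} :=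
        measureReal_mono hsub
    _ ≤ (ENNReal.ofReal (variance (connPairCount P Q) μ / (EK / 2) ^ 2)).toReal :=
        ENNReal.toReal_mono ENNReal.ofReal_ne_top hcheb
    _ = variance (connPairCount P Q) μ / (EK / 2) ^ 2 :=
        ENNReal.toReal_ofReal (div_nonneg (variance_nonneg _ _) (sq_nonneg _))
    _ ≤ T / (EK / 2) ^ 2 := div_le_div_of_nonneg_right hvar (sq_nonneg _)
    _ = 4 * T / EK ^ 2 := by
        field_simp
        ring

/-- **Markov** for `S`: `P(S ≥ M) ≤ T/M`. [folklore] -/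
theorem real_connQuadCount_ge_le {M : ℝ} (hM : 0 < M) :
    (bondPercolation G p).real {ω | M ≤ connQuadCount P Q ω} ≤ connQuadSum G p P Q / M := by
  have h := mul_meas_ge_le_integral_of_nonneg (ae_of_all _ (connQuadCount_nonneg P Q))
    (integrable_connQuadCount G p P Q) M
  rw [integral_connQuadCount] at h
  rw [le_div_iff₀ hM, mul_comm]
  exact h

/-- **The good event has large probability**: if `E ⊇ {K > EK/2} ∩ {S ≤ M}` then
`P(E) ≥ 1 - (4T/(EK)² + T/M)` (Chebyshev, Markov and a union bound; no measurability of `E` is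
needed). [cite: Aizenman1997, §4 (proof of Thm. 4)] -/
theorem real_ge_of_connPairCount_connQuadCount (hEK : 0 < meanConnPairCount G p P Q)
    {M : ℝ} (hM : 0 < M) {E : Set (BondConfig V)}
    (hE : ∀ ω, meanConnPairCount G p P Q / 2 < connPairCount P Q ω → connQuadCount P Q ω ≤ M →
      ω ∈ E) :
    1 - (4 * connQuadSum G p P Q / meanConnPairCount G p P Q ^ 2 + connQuadSum G p P Q / M) ≤
      (bondPercolation G p).real E := by
  set μ := bondPercolation G p with hμ
  set EK := meanConnPairCount G p P Q with hEKdef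
  set T := connQuadSum G p P Q with hTdef
  set Good : Set (BondConfig V) := {ω | EK / 2 < connPairCount P Q ω ∧ connQuadCount P Q ω ≤ M} with hGood
  have h1 : μ.real Good ≤ μ.real E := measureReal_mono fun ω hω => hE ω hω.1 hω.2
  have h2 : μ.real Goodᶜ ≤ 4 * T / EK ^ 2 + T / M := by
    have hsub : Goodᶜ ⊆ {ω | connPairCount P Q ω ≤ EK / 2} ∪ {ω | M ≤ connQuadCount P Q ω} := by
      intro ω hω
      simp only [hGood, Set.mem_compl_iff, Set.mem_setOf_eq, not_and_or, not_lt, not_le] at hω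
      rcases hω with h | h
      · exact Or.inl h
      · exact Or.inr h.le
    calc μ.real Goodᶜ ≤ μ.real ({ω | connPairCount P Q ω ≤ EK / 2} ∪ {ω | M ≤ connQuadCount P Q ω}) :=
          measureReal_mono hsub
      _ ≤ μ.real {ω | connPairCount P Q ω ≤ EK / 2} + μ.real {ω | M ≤ connQuadCount P Q ω} :=
          measureReal_union_le _ _
      _ ≤ 4 * T / EK ^ 2 + T / M :=
          add_le_add (real_connPairCount_le_half_le G p P Q hEK) (real_connQuadCount_ge_le G p P Q hM)
  have h3 : (1 : ℝ) ≤ μ.real Good + μ.real Goodᶜ := by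
    calc (1 : ℝ) = μ.real Set.univ := probReal_univ.symm
      _ = μ.real (Good ∪ Goodᶜ) := by rw [Set.union_compl_self]
      _ ≤ μ.real Good + μ.real Goodᶜ := measureReal_union_le _ _
  linarith

end SecondMoment

/-! ### Assembly on `ℤ^d`, `d = m + 7` -/

section Assembly

variable {m : ℕ} (p : unitInterval)

/-- **`N_L ≥ ε L^{d-6}` with probability `≥ 1 - κ (L^{-(d-6)} + ε)`** for fixed `L ≥ 1`, `ε > 0`,
under the two halves of (t-c) with `η = 0` in natural-power form (`κ = 4 C_diag/(C' 2^d)²`): the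
quantitative core of Aizenman 1997, Thm. 4 (3).
[cite: Aizenman1997, Thm. 4 (3) and §4 (Lemmas 2–4, proof of Lemma 3)] -/
theorem real_numSpanning_ge {C' C₁ : ℝ} (hC' : 0 < C')
    (hLow : ∀ x y : Site (m + 7), x ≠ y → C' * (‖x - y‖ ^ (m + 5))⁻¹ ≤ tau (m + 7) p x y)
    (hU : ∀ x y : Site (m + 7), tau (m + 7) p x y ≤ C₁ * rieszWt (m + 5) (x - y))
    {L : ℕ} (hL : 1 ≤ L) {ε : ℝ} (hε : 0 < ε) :
    1 - 4 * spanningDiagConst m C₁ / (C' * 2 ^ (m + 7)) ^ 2 * ((((L : ℝ)) ^ (m + 1))⁻¹ + ε) ≤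
      (bondPercolation (zdGraph (m + 7)) p).real
        {ω | ENNReal.ofReal (ε * (L : ℝ) ^ (m + 1)) ≤ (numSpanningClusters (m + 7) L ω : ℝ≥0∞)} := by
  set μ := bondPercolation (zdGraph (m + 7)) p with hμ
  set P := plate (m + 6) L (-(L : ℤ)) with hP
  set Q := plate (m + 6) L (L : ℤ) with hQ
  set EK := meanConnPairCount (zdGraph (m + 7)) p P Q with hEKdef
  set T := connQuadSum (zdGraph (m + 7)) p P Q with hTdef
  have hL0 : (0 : ℝ) < L := by exact_mod_cast hL
  set c₀ := C' * 2 ^ (m + 7) with hc₀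
  have hc₀0 : 0 < c₀ := by positivity
  -- the two moment bounds
  have hEKge : c₀ * (L : ℝ) ^ (m + 7) ≤ EK := le_sum_faces_tau p hC'.le hLow hL
  have hEK : 0 < EK := lt_of_lt_of_le (by positivity) hEKge
  have hT : T ≤ spanningDiagConst m C₁ * (L : ℝ) ^ (m + 13) := sum_real_openConn₄_le p hU hL
  have hT0 : 0 ≤ T := connQuadSum_nonneg _ p P Q
  have hC₁ : 0 ≤ C₁ := zero_le_one.trans (one_le_of_tau_le_rieszWt p hU)
  have hCT : 0 ≤ spanningDiagConst m C₁ := spanningDiagConst_nonneg hC₁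
  -- the threshold `M`
  set r := ε * (L : ℝ) ^ (m + 1) with hr
  have hr0 : 0 < r := by positivity
  set M := (EK / 2) ^ 2 / r with hM
  have hM0 : 0 < M := by positivity
  -- faces ⊆ faces
  have hPf : ∀ x ∈ P, x ∈ leftFace (m + 7) L := fun x hx => by
    rw [← coe_plate_neg_eq_leftFace, Finset.mem_coe]; exact hx
  have hQf : ∀ y ∈ Q, y ∈ rightFace (m + 7) L := fun y hy => by
    rw [← coe_plate_eq_rightFace, Finset.mem_coe]; exact hy
  -- on the good event, `N_L ≥ r`
  have hE : ∀ ω, EK / 2 < connPairCount P Q ω → connQuadCount P Q ω ≤ M →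
      ω ∈ {ω | ENNReal.ofReal (ε * (L : ℝ) ^ (m + 1)) ≤ (numSpanningClusters (m + 7) L ω : ℝ≥0∞)} := by
    intro ω hK hS
    refine ofReal_le_numSpanningClusters hPf hQf (lt_connClusterCount_of P Q hM0 hS ?_).le
    have hK0 : 0 < EK / 2 := half_pos hEK
    calc r * M = (EK / 2) ^ 2 := by rw [hM]; field_simp
      _ < connPairCount P Q ω ^ 2 := pow_lt_pow_left₀ hK hK0.le two_ne_zero
  have hgood := real_ge_of_connPairCount_connQuadCount (zdGraph (m + 7)) p P Q hEK hM0 hE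
  refine le_trans ?_ hgood
  -- compare the error terms
  have hκ : 0 ≤ 4 * spanningDiagConst m C₁ / c₀ ^ 2 := by positivity
  have hX : 4 * T / EK ^ 2 ≤ 4 * spanningDiagConst m C₁ / c₀ ^ 2 * (((L : ℝ)) ^ (m + 1))⁻¹ := by
    have hEK2 : (c₀ * (L : ℝ) ^ (m + 7)) ^ 2 ≤ EK ^ 2 := pow_le_pow_left₀ (by positivity) hEKge 2
    calc 4 * T / EK ^ 2 ≤ 4 * (spanningDiagConst m C₁ * (L : ℝ) ^ (m + 13)) / EK ^ 2 :=
          div_le_div_of_nonneg_right (by linarith) (sq_nonneg _)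
      _ ≤ 4 * (spanningDiagConst m C₁ * (L : ℝ) ^ (m + 13)) / (c₀ * (L : ℝ) ^ (m + 7)) ^ 2 :=
          div_le_div_of_nonneg_left (by positivity) (by positivity) hEK2
      _ = 4 * spanningDiagConst m C₁ / c₀ ^ 2 * (((L : ℝ)) ^ (m + 1))⁻¹ := by
          field_simp
          ring
  have hY : T / M ≤ 4 * spanningDiagConst m C₁ / c₀ ^ 2 * ε := by
    have hEK2 : (c₀ * (L : ℝ) ^ (m + 7)) ^ 2 ≤ EK ^ 2 := pow_le_pow_left₀ (by positivity) hEKge 2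
    calc T / M = 4 * (T * r) / EK ^ 2 := by rw [hM]; field_simp; ring
      _ ≤ 4 * (spanningDiagConst m C₁ * (L : ℝ) ^ (m + 13) * r) / EK ^ 2 :=
          div_le_div_of_nonneg_right (by nlinarith [hr0.le]) (sq_nonneg _)
      _ ≤ 4 * (spanningDiagConst m C₁ * (L : ℝ) ^ (m + 13) * r) / (c₀ * (L : ℝ) ^ (m + 7)) ^ 2 :=
          div_le_div_of_nonneg_left (by positivity) (by positivity) hEK2
      _ = 4 * spanningDiagConst m C₁ / c₀ ^ 2 * ε := by
          rw [hr]
          field_simp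
          ring
  linarith

/-- The error term of `real_numSpanning_ge` tends to zero along `ε_L → 0`. [folklore] -/
private theorem tendsto_one_sub_errorTerm (κ : ℝ) {ε : ℕ → ℝ} (hε : Tendsto ε atTop (𝓝 0)) :
    Tendsto (fun L : ℕ => 1 - κ * ((((L : ℝ)) ^ (m + 1))⁻¹ + |ε L|)) atTop (𝓝 1) := by
  have h1 : Tendsto (fun L : ℕ => (((L : ℝ)) ^ (m + 1))⁻¹) atTop (𝓝 0) := by
    have h := (tendsto_pow_atTop (α := ℝ) (n := m + 1) (by omega)).comp tendsto_natCast_atTop_atTop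
    exact h.inv_tendsto_atTop
  have h2 : Tendsto (fun L : ℕ => |ε L|) atTop (𝓝 0) := by
    have h := hε.abs
    rwa [abs_zero] at h
  have h3 := ((h1.add h2).const_mul κ).const_sub 1
  simpa using h3

/-- **Discharge of the barrier `SpanningClustersAboveSix`** (Aizenman 1997, Thm. 4 (1) and (3)):
in every dimension `d > 6`, if (t-c) holds with `η = 0` (`TwoPointBoundedRatio d`), then as
`L → ∞` the probability that `Λ_L` is spanned (bulk b.c.) tends to `1`, and for every `ε_L → 0`,
`P_{p_c}(N_L ≥ ε_L L^{d-6}) → 1`. Proof by the second-moment method on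
`K = Σ_C |C∩∂Λ_-||C∩∂Λ_+|` (mean `≍ L^d`, variance `≲ L^{d+6}` by Lemmas 2 and 4), Markov
for `S = Σ_C |C∩∂Λ_-|²|C∩∂Λ_+|²` (`E S ≲ L^{d+6}`), and Cauchy–Schwarz `N_L ≥ K²/S`; item (1) from
item (3) with `ε_L = 1/L`. [cite: Aizenman1997, Thm. 4 (1), (3) and §4 (Lemmas 2–4)] -/
theorem SpanningClustersAboveSix_holds : SpanningClustersAboveSix := by
  intro d _ hd hτ
  obtain ⟨m, rfl⟩ : ∃ m, d = m + 7 := ⟨d - 7, by omega⟩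
  obtain ⟨C', C, hC', hC'C, hb⟩ := hτ.natPow (by omega)
  set μ := bondPercolation (zdGraph (m + 7)) (criticalProbI (m + 7)) with hμ
  have e5 : m + 7 - 2 = m + 5 := by omega
  have hLow : ∀ x y : Site (m + 7), x ≠ y →
      C' * (‖x - y‖ ^ (m + 5))⁻¹ ≤ tau (m + 7) (criticalProbI (m + 7)) x y :=
    fun x y hxy => by have h := (hb x y hxy).1; rwa [e5] at h
  have hUp : ∀ x y : Site (m + 7), x ≠ y →
      tau (m + 7) (criticalProbI (m + 7)) x y ≤ C * (‖x - y‖ ^ (m + 5))⁻¹ :=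
    fun x y hxy => by have h := (hb x y hxy).2; rwa [e5] at h
  have hU := tau_le_rieszWt_of_upper (criticalProbI (m + 7)) hUp
  have hC₁ : 0 ≤ max C 1 := le_trans zero_le_one (le_max_right _ _)
  set κ := 4 * spanningDiagConst m (max C 1) / (C' * 2 ^ (m + 7)) ^ 2 with hκ
  have hκ0 : 0 ≤ κ := by
    have hd0 : 0 ≤ spanningDiagConst m (max C 1) := spanningDiagConst_nonneg hC₁
    positivity
  -- item (3)
  have key : ∀ ε : ℕ → ℝ, Tendsto ε atTop (𝓝 0) →
      Tendsto (fun L : ℕ => μ.real {ω | ENNReal.ofReal (ε L * (L : ℝ) ^ (m + 1)) ≤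
        (numSpanningClusters (m + 7) L ω : ℝ≥0∞)}) atTop (𝓝 1) := by
    intro ε hε
    refine tendsto_of_tendsto_of_tendsto_of_le_of_le' (tendsto_one_sub_errorTerm (m := m) κ hε)
      tendsto_const_nhds ?_ (Filter.Eventually.of_forall fun L => measureReal_le_one)
    filter_upwards [Filter.eventually_ge_atTop 1] with L hL
    rcases le_or_gt (ε L) 0 with hεL | hεL
    · -- `ε_L ≤ 0`: the event is sure
      have hev : {ω | ENNReal.ofReal (ε L * (L : ℝ) ^ (m + 1)) ≤
          (numSpanningClusters (m + 7) L ω : ℝ≥0∞)} = Set.univ :=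
        Set.eq_univ_of_forall fun ω => by
          rw [Set.mem_setOf_eq, ENNReal.ofReal_of_nonpos (mul_nonpos_of_nonpos_of_nonneg hεL (by positivity))]
          exact bot_le
      rw [hev, probReal_univ]
      have : 0 ≤ κ * ((((L : ℝ)) ^ (m + 1))⁻¹ + |ε L|) := by positivity
      linarith
    · have h := real_numSpanning_ge (criticalProbI (m + 7)) hC' hLow hU hL hεL
      rw [abs_of_pos hεL]
      exact h
  have e6 : ∀ L : ℕ, (L : ℝ) ^ (m + 7 - 6) = (L : ℝ) ^ (m + 1) := fun L => by
    rw [show m + 7 - 6 = m + 1 by omega]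
  simp only [e6]
  refine ⟨?_, key⟩
  -- item (1) from item (3) with `ε_L = 1/L`
  have hε : Tendsto (fun L : ℕ => ((L : ℝ))⁻¹) atTop (𝓝 0) :=
    tendsto_inv_atTop_zero.comp tendsto_natCast_atTop_atTop
  refine tendsto_of_tendsto_of_tendsto_of_le_of_le' (key _ hε) tendsto_const_nhds ?_
    (Filter.Eventually.of_forall fun L => measureReal_le_one)
  filter_upwards [Filter.eventually_ge_atTop 1] with L hL
  refine measureReal_mono (fun ω hω => mem_bulkSpanning_of_ofReal_le ?_ hω)
  have hL0 : (0 : ℝ) < L := by exact_mod_cast hL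
  positivity

end Assembly

end Literature.Barriers.CriticalPhenomena

end
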